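import Summits.RiemannHypothesis.RiemannHypothesis.Theorems.PfPersistenceF3SharpLocalDatum
import Summits.RiemannHypothesis.RiemannHypothesis.Theorems.PfPersistenceF5TailTwins

/-!
# F3 — FE-honest twins `ζ·(1 + b p^{-s} + p^{1-2s})` — part 2/5: generic TWIN lemmas — pub-rhpf fake-3

HONEST FRAMING: mechanism/rigidity campaign; no RH claims.  Split of the single staged module `HOME/lean/PFPersistence/F3SharpLocal.lean` v3 (sha16 1e7c8001eda6007d,
1050 lines, `lean check` rc 0 / 0 sorries) into five ≤ 400-line modules for the gate's line lint (REFEREE r10-b):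
`…F3SharpLocalDatum` (datum, SHAPE-TWIN identity, the three statements) → `…F3SharpLocalTwin` (generic twin
lemmas) → `…F3SharpLocalBound` (THEOREM F3-A) → `…F3SharpLocalTemperedAux` (Newton sums, prime-term difference,
PSD autocorrelation, Fejér) → `…F3SharpLocalTempered` (TEMPERED TRANSFER).  Every `def`/`theorem` statement and
proof is verbatim from v3 (v2 3b05073fba483e09 = ADJ A25 add.3 for F3-A); only headers/imports are per-file.
This part: translation / twin test functions, their supports, translation invariance of the autocorrelation,
and the autocorrelation of the twin at `0` and `±2c` (fake-5's F5 lemmas, copied; RULING A25(a)).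
-/

set_option linter.dupNamespace false

noncomputable section

open MeasureTheory Set Filter Complex
open scoped Real Topology

namespace Summit.RiemannHypothesis.RiemannHypothesis.Theorems.PfPersistenceBarrier

open Literature.NumberTheory.LFunctions ExplicitDatum

/-! ## Proof of THEOREM F3-A (kernel; RULING A25(a): adapt fake-5's `F5TailTwins.tailDialRayleighBound`)

The generic twin lemmas below (`translate`, `twin`, supports, the autocorrelation of the twin at `0` and
`±2c`) are fake-5's (`HOME/lean/PFPersistence/F5TailTwins.lean`, namespace `…LFunctions.F5`), copied so that
this file stays self-contained; the new inputs are the single visible `P`-mass of `F_{p,b}` at `log p`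
(`sharpLocal_primeTerm_sub`) and the conductor term `2 log p·A_g(0)` (`sharpLocal_quadratic_decomp`).

LANDING NOTE (barrier-prover g2, lander per lead §H.5; gate bounce p187060 `dedup.landed`): fake-5's twin lemmas
are now IN THE TREE (`Theorems/PfPersistenceF5TailTwins.lean`, namespace `…Theorems.PfPersistenceF5TailTwins`),
so the eight verbatim copies (`isWeilTest_twin`, `tsupport_twin_subset`, `mul_conj_eq_zero_of_shift`,
`tsupport_add_mul_subset`, `twin_mul_conj_twin_sub/_add`, `weilConv_weilReflect_twin_(neg_)two_mul`) and the
definitions `twin`, `translate` are RE-EXPORTED from that module instead of re-declared (the gate refuses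
restatements of landed theorems); `shiftFn` is kept as a reducible synonym of `translate` so that parts 3–5
elaborate unchanged; the three new lemmas (`norm_sq_twin`, `integral_norm_sq_twin`,
`weilConv_weilReflect_twin_zero`) keep fake-3's statements and proofs.  No statement of parts 1, 3, 4, 5 changes. -/

namespace F3A


open scoped ComplexConjugate

variable {g : ℝ → ℂ} {b c : ℝ}

export Summit.RiemannHypothesis.RiemannHypothesis.Theorems.PfPersistenceF5TailTwins
  (translate twin twin_eq_add isWeilTest_twin tsupport_twin_subset mul_conj_eq_zero_of_shift
    tsupport_add_mul_subset twin_mul_conj_twin_sub twin_mul_conj_twin_add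
    weilConv_weilReflect_twin_two_mul weilConv_weilReflect_twin_neg_two_mul)

/-- Translation `(τ_c g)(x) = g (x - c)` (the tree's `weilTranslate g c`; fake-3's name for fake-5's `translate`,
kept as a reducible synonym). [folklore] -/
abbrev shiftFn (c : ℝ) (g : ℝ → ℂ) : ℝ → ℂ := translate c g

/-- `shiftFn c g` is the tree's `weilTranslate g c` (definitional). [folklore] -/
theorem shiftFn_eq_weilTranslate (c : ℝ) (g : ℝ → ℂ) : shiftFn c g = weilTranslate g c := rfl

/-- Translates of Weil tests are Weil tests. [folklore] -/
theorem isWeilTest_shiftFn (hg : IsWeilTest g) (c : ℝ) : IsWeilTest (shiftFn c g) :=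
  hg.weilTranslate c

/-- Support of a shiftFn. [folklore] -/
theorem tsupport_shiftFn_subset (hs : tsupport g ⊆ Icc (-b) b) (c : ℝ) :
    tsupport (shiftFn c g) ⊆ Icc (-b + c) (b + c) :=
  PfPersistenceF5TailTwins.tsupport_translate_subset hs c

/-- The autocorrelation `g ⋆ g̃` is translation invariant. [folklore] -/
theorem weilConv_weilReflect_shiftFn (c : ℝ) (g : ℝ → ℂ) :
    weilConv (shiftFn c g) (weilReflect (shiftFn c g)) = weilConv g (weilReflect g) :=
  PfPersistenceF5TailTwins.weilConv_weilReflect_translate c g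

/-- The Weil quadratic form is translation invariant. [folklore] -/
theorem weilQuadratic_shiftFn (c : ℝ) (g : ℝ → ℂ) :
    weilQuadratic (shiftFn c g) = weilQuadratic g :=
  PfPersistenceF5TailTwins.weilQuadratic_translate c g

/-! ### The autocorrelation of the twin at `0` -/

/-- Pointwise: the two shiftFns have disjoint supports, so `‖twin‖² = ‖τ_{-c}g‖² + σ²‖τ_c g‖²`. [folklore] -/
theorem norm_sq_twin (hs : tsupport g ⊆ Icc (-b) b) (hb : 0 < b) (hc : b < c) (σ : ℝ) (x : ℝ) :
    ‖twin c σ g x‖ ^ 2 = ‖g (x + c)‖ ^ 2 + σ ^ 2 * ‖g (x - c)‖ ^ 2 := by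
  have e1 : twin c σ g x = g (x + c) - σ * g (x - c) := by
    simp only [twin, translate, sub_neg_eq_add]
  have h0 : g (x + c) * conj (g (x - c)) = 0 :=
    mul_conj_eq_zero_of_shift hs
      (by rw [show x + c - (x - c) = 2 * c by ring, abs_of_pos (by linarith)]; linarith)
  rcases mul_eq_zero.1 h0 with h | h
  · rw [e1, h]
    simp [norm_neg, mul_pow, sq_abs]
  · have h' : g (x - c) = 0 := by simpa using h
    rw [e1, h']
    simp

/-- `‖twin‖₂² = (1 + σ²)‖g‖₂²`. [folklore] -/
theorem integral_norm_sq_twin (hg : IsWeilTest g) (hs : tsupport g ⊆ Icc (-b) b) (hb : 0 < b)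
    (hc : b < c) (σ : ℝ) :
    ∫ x, ‖twin c σ g x‖ ^ 2 = (1 + σ ^ 2) * ∫ x, ‖g x‖ ^ 2 := by
  have hpt : (fun x ↦ ‖twin c σ g x‖ ^ 2) = fun x ↦ ‖g (x + c)‖ ^ 2 + σ ^ 2 * ‖g (x - c)‖ ^ 2 :=
    funext (norm_sq_twin hs hb hc σ)
  have hsq : (fun x ↦ ‖g x‖ ^ 2) = fun x ↦ ‖g x‖ * ‖g x‖ := funext fun x ↦ sq _
  have hint : Integrable (fun x ↦ ‖g x‖ ^ 2) := by
    rw [hsq]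
    exact (hg.1.continuous.norm.mul hg.1.continuous.norm).integrable_of_hasCompactSupport
      hg.2.norm.mul_right
  have hint1 : Integrable (fun x ↦ ‖g (x + c)‖ ^ 2) := hint.comp_add_right c
  have hint2 : Integrable (fun x ↦ σ ^ 2 * ‖g (x - c)‖ ^ 2) := (hint.comp_sub_right c).const_mul _
  rw [hpt, integral_add hint1 hint2, integral_const_mul]
  have k1 := integral_add_right_eq_self (μ := (volume : Measure ℝ)) (fun t : ℝ ↦ ‖g t‖ ^ 2) c
  have k2 := integral_sub_right_eq_self (μ := (volume : Measure ℝ)) (fun t : ℝ ↦ ‖g t‖ ^ 2) c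
  rw [k1, k2]
  ring

/-- `A_g(0) = (1 + σ²)‖g₁‖₂²` for the twin. [folklore] -/
theorem weilConv_weilReflect_twin_zero (hg : IsWeilTest g) (hs : tsupport g ⊆ Icc (-b) b)
    (hb : 0 < b) (hc : b < c) (σ : ℝ) :
    weilConv (twin c σ g) (weilReflect (twin c σ g)) 0 =
      (((1 + σ ^ 2) * ∫ t, ‖g t‖ ^ 2 : ℝ) : ℂ) := by
  rw [weilConv_weilReflect_apply_zero, integral_norm_sq_twin hg hs hb hc σ]

end F3A

end Summit.RiemannHypothesis.RiemannHypothesis.Theorems.PfPersistenceBarrier
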